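import Summits.Parity.GeneralizedHardyLittlewood.Theorems.PrimeLevelFamEdgeMomentsBeyondDiagonalDiagRemBoseTwoSeq
import HarnessLib

/-!
# Route `PrimeLevelFamEdge`, crux K_A `MomentsBeyondDiagonal` (stmt-Parity-20007), line «petersson_layers» v4, stub `stub_diag`:
# **the continued Bose remainders `r₂₃, r₃₀, r₃₁, r₃₂, r₃₃` of ORDER `(3,3)` in `Π`-form (moments `μ₂, μ₄, μ₆` explicit), and the
# generic two-sequence estimate WITH the small-argument pointwise bound under one constant** (first bricks of (R₃₃))

The order-`(3,3)` piece of `stub_diag` (top order of rung `N = 3`) is reduced to (Poly₃₃) and the remainder estimate (R₃₃)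
(`…DiagDecorOrderThreeThreeAssembly.orderThreeThree_target_of_poly_of_remainder`, lineage famedge-2). (R₃₃) carries the
SIXTEEN kernels `r_ab`, `a, b ≤ 3`; eleven are in the tree in `Π`-form (`…DiagRemBoseTwoSeq`, `…DiagRemTwoTwoBoseA/B`,
`…DiagRemOneThreeBose`). This file adds the five missing ones, in exactly the `Π`-form printed in the hypothesis `hR` of the
order-`(3,3)` assembly:

* `envelope_aux8`, `weaken_second_term8` — the common envelope `9C₀(1+|log 2αY²|)⁸` (`a + b + 1 ≤ 7`);
* `abs_doubleSum_rem_le₃₃b` — **`Π₂₃ = Π₃₂-shape = −L⁶/384 + (μ₂/8)L⁴ − (μ₄/2)L² + E`, `Π₃₀ = −L⁴/64 − (3μ₂/2)L² + E₃₀`,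
  `Π₃₁ = L⁵/160 − 2μ₄L + E₃₁`, `Π₃₃ = L⁷/896 − (3μ₂/40)L⁵ + (μ₄/2)L³ − 2μ₆L + E₃₃`** (`μ_m = ∫₀¹logᵐv·v/(1+v²)²`, `μ₀ = 1/4`;
  the odd moments cancel), five two-sequence Abel estimates with common `C₀`;
* `abs_bose_rem_twoSeq_and_small` — for EVERY `(a,b)`: the two-sequence estimate of `…DiagRemBoseTwoSeq.abs_doubleSum_bose_rem_le₂`
  together with the pointwise bound `|r_ab(y)| ≤ C₀√y` (`0 < y ≤ 1`, `…DiagBoseMixedRemainderSqrt`-chain `abs_bose_rem_small_le_sqrt`)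
  under ONE constant and ONE `E_ab` (generic KMV form) — the input of the δ-subtraction corner `c²·ℓ⁺(1)ⁱℓ⁺(1)ʲ·|r_ab(α)|` of every
  both-sided monomial of (R₃₃) (`P₂ ⊗ P₂ · r_ab`, `a + b ≤ 2`; `…DiagRemTwoTwoDeltaSub`), as `…DiagRemTwoTwoBoseZero` did for `r₀₀`.

Def-free; theorems only. Helper `--supports stmt-Parity-20007`; closes nothing; K_A, K_B and the Parity summit are NOT proved;
nothing about Landau–Siegel zeros.

## References
* E. Kowalski, P. Michel, J. VanderKam, J. reine angew. Math. 526 (2000), (22)–(28) pp. 12–15 and Prop. 5.1 p. 18.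
  [cite: KowalskiMichelVanderKam2000, Prop. 5.1 — derivation (corner of the diagonal, general Q, remainder weights, order (3,3))]
-/

noncomputable section

open Real MeasureTheory Finset

namespace Summit.Parity.GeneralizedHardyLittlewood.Theorems.MomentsBeyondDiagonal.DiagCorner

open Summit.Parity.GeneralizedHardyLittlewood.Theorems.BeyondDiagonalBeatsQuarter.Corner
open Summit.Parity.GeneralizedHardyLittlewood.Theorems.MomentsBeyondDiagonal.DiagLines

/-- `3(C₀ + C₀x^N) + 2C₀ + C₀x^N·x ≤ 9C₀x⁸` for `C₀ ≥ 0`, `x ≥ 1`, `N ≤ 7`. [folklore] -/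
theorem envelope_aux8 {C₀ x : ℝ} (hC : 0 ≤ C₀) (hx : 1 ≤ x) {N : ℕ} (hN : N ≤ 7) :
    3 * (C₀ + C₀ * x ^ N) + 2 * C₀ + C₀ * x ^ N * x ≤ 9 * C₀ * x ^ 8 := by
  have h4 : 1 ≤ x ^ 8 := one_le_pow₀ hx
  have hN4 : x ^ N ≤ x ^ 8 := pow_le_pow_right₀ hx (by omega)
  have hN1 : x ^ N * x ≤ x ^ 8 := by
    rw [← pow_succ]; exact pow_le_pow_right₀ hx (by omega)
  nlinarith [mul_le_mul_of_nonneg_left h4 hC, mul_le_mul_of_nonneg_left hN4 hC,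
    mul_le_mul_of_nonneg_left hN1 hC]

/-- Weakening of the second term of the two-sequence estimate to the common envelope `9C₀(1+|log(2αY²)|)⁸`
(`N ≤ 7`). [folklore] -/
theorem weaken_second_term8 {S T Sj η L C₀ x : ℝ} {i N : ℕ} (hSj : 0 ≤ Sj) (hη : 0 ≤ η) (hL : 0 ≤ L)
    (hC : 0 ≤ C₀) (hx : 1 ≤ x) (hN : N ≤ 7)
    (h : S ≤ T + Sj * ((2 * η) * (L ^ i * (3 * (C₀ + C₀ * x ^ N) + 2 * C₀ + C₀ * x ^ N * x)))) :
    S ≤ T + Sj * ((2 * η) * (L ^ i * (9 * C₀ * x ^ 8))) := by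
  have hw := envelope_aux8 hC hx hN
  have : Sj * ((2 * η) * (L ^ i * (3 * (C₀ + C₀ * x ^ N) + 2 * C₀ + C₀ * x ^ N * x))) ≤
      Sj * ((2 * η) * (L ^ i * (9 * C₀ * x ^ 8))) := by
    have hLi : 0 ≤ L ^ i := pow_nonneg hL i
    gcongr
  linarith

set_option maxHeartbeats 1600000 in
-- five large kernel statements
/-- **THE CONTINUED BOSE REMAINDERS `r₂₃, r₃₀, r₃₁, r₃₂, r₃₃` IN `Π`-FORM (moments `μ₂, μ₄, μ₆` explicit), TWO-SEQUENCE ABEL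
ESTIMATE WITH THE COMMON ENVELOPE `9C₀(1+|log 2αY²|)⁸`.**
[cite: KowalskiMichelVanderKam2000, (22)–(28) and Prop. 5.1 — derivation (corner of the diagonal, general Q, order (3,3))] -/
theorem abs_doubleSum_rem_le₃₃b : ∃ E₂₃ E₃₀ E₃₁ E₃₂ E₃₃ C₀ : ℝ, 0 ≤ C₀ ∧
    ∀ (a₁ a₂ : ℕ → ℝ) (Y α B η : ℝ) (K₁ i j : ℕ), 1 ≤ Y → 0 < α → 1 ≤ i → 1 ≤ j →
      (∀ e : ℕ, e ≤ ⌊Y⌋₊ → |∑ k ∈ Icc 1 e, a₂ k| ≤ B) → (∀ e : ℕ, K₁ ≤ e → |∑ k ∈ Icc 1 e, a₁ k| ≤ η) →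
      2 * α * K₁ * Y ≤ 1 →
    |∑ k₁ ∈ Icc 1 ⌊Y⌋₊, ∑ k₂ ∈ Icc 1 ⌊Y⌋₊,
        a₁ k₁ * a₂ k₂ * ellp Y k₁ ^ i * ellp Y k₂ ^ j *
          ((∫ u₁ in Set.Ioi (0 : ℝ), Real.log u₁ ^ 2 * ∫ u₂ in Set.Ioi ((α * k₁ * k₂) / u₁),
              Real.exp (-(u₁ + u₂)) / (1 - Real.exp (-(u₁ + u₂))) ^ 2 * Real.log u₂ ^ 3) -
            (-(Real.log (1 / (α * k₁ * k₂)) ^ 6) / 384 + (∫ v in Set.Ioc (0 : ℝ) 1, Real.log v ^ 2 * (v / (1 + v ^ 2) ^ 2)) / 8 * Real.log (1 / (α * k₁ * k₂)) ^ 4 - (∫ v in Set.Ioc (0 : ℝ) 1, Real.log v ^ 4 * (v / (1 + v ^ 2) ^ 2)) / 2 * Real.log (1 / (α * k₁ * k₂)) ^ 2 + E₂₃))| ≤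
      (∑ k ∈ Icc 1 ⌊Y⌋₊, |a₁ k| * ellp Y k ^ i) * (B * (Real.log Y ^ j * (3 * C₀ * Real.sqrt (2 * α * K₁ * Y)))) +
        (∑ k ∈ Icc 1 ⌊Y⌋₊, |a₂ k| * ellp Y k ^ j) *
          ((2 * η) * (Real.log Y ^ i * (9 * C₀ * (1 + |Real.log (2 * α * Y ^ 2)|) ^ 8))) ∧
    |∑ k₁ ∈ Icc 1 ⌊Y⌋₊, ∑ k₂ ∈ Icc 1 ⌊Y⌋₊,
        a₁ k₁ * a₂ k₂ * ellp Y k₁ ^ i * ellp Y k₂ ^ j *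
          ((∫ u₁ in Set.Ioi (0 : ℝ), Real.log u₁ ^ 3 * ∫ u₂ in Set.Ioi ((α * k₁ * k₂) / u₁),
              Real.exp (-(u₁ + u₂)) / (1 - Real.exp (-(u₁ + u₂))) ^ 2) -
            (-(Real.log (1 / (α * k₁ * k₂)) ^ 4) / 64 - 3 * (∫ v in Set.Ioc (0 : ℝ) 1, Real.log v ^ 2 * (v / (1 + v ^ 2) ^ 2)) / 2 * Real.log (1 / (α * k₁ * k₂)) ^ 2 + E₃₀))| ≤
      (∑ k ∈ Icc 1 ⌊Y⌋₊, |a₁ k| * ellp Y k ^ i) * (B * (Real.log Y ^ j * (3 * C₀ * Real.sqrt (2 * α * K₁ * Y)))) +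
        (∑ k ∈ Icc 1 ⌊Y⌋₊, |a₂ k| * ellp Y k ^ j) *
          ((2 * η) * (Real.log Y ^ i * (9 * C₀ * (1 + |Real.log (2 * α * Y ^ 2)|) ^ 8))) ∧
    |∑ k₁ ∈ Icc 1 ⌊Y⌋₊, ∑ k₂ ∈ Icc 1 ⌊Y⌋₊,
        a₁ k₁ * a₂ k₂ * ellp Y k₁ ^ i * ellp Y k₂ ^ j *
          ((∫ u₁ in Set.Ioi (0 : ℝ), Real.log u₁ ^ 3 * ∫ u₂ in Set.Ioi ((α * k₁ * k₂) / u₁),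
              Real.exp (-(u₁ + u₂)) / (1 - Real.exp (-(u₁ + u₂))) ^ 2 * Real.log u₂) -
            (Real.log (1 / (α * k₁ * k₂)) ^ 5 / 160 - 2 * (∫ v in Set.Ioc (0 : ℝ) 1, Real.log v ^ 4 * (v / (1 + v ^ 2) ^ 2)) * Real.log (1 / (α * k₁ * k₂)) + E₃₁))| ≤
      (∑ k ∈ Icc 1 ⌊Y⌋₊, |a₁ k| * ellp Y k ^ i) * (B * (Real.log Y ^ j * (3 * C₀ * Real.sqrt (2 * α * K₁ * Y)))) +
        (∑ k ∈ Icc 1 ⌊Y⌋₊, |a₂ k| * ellp Y k ^ j) *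
          ((2 * η) * (Real.log Y ^ i * (9 * C₀ * (1 + |Real.log (2 * α * Y ^ 2)|) ^ 8))) ∧
    |∑ k₁ ∈ Icc 1 ⌊Y⌋₊, ∑ k₂ ∈ Icc 1 ⌊Y⌋₊,
        a₁ k₁ * a₂ k₂ * ellp Y k₁ ^ i * ellp Y k₂ ^ j *
          ((∫ u₁ in Set.Ioi (0 : ℝ), Real.log u₁ ^ 3 * ∫ u₂ in Set.Ioi ((α * k₁ * k₂) / u₁),
              Real.exp (-(u₁ + u₂)) / (1 - Real.exp (-(u₁ + u₂))) ^ 2 * Real.log u₂ ^ 2) -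
            (-(Real.log (1 / (α * k₁ * k₂)) ^ 6) / 384 + (∫ v in Set.Ioc (0 : ℝ) 1, Real.log v ^ 2 * (v / (1 + v ^ 2) ^ 2)) / 8 * Real.log (1 / (α * k₁ * k₂)) ^ 4 - (∫ v in Set.Ioc (0 : ℝ) 1, Real.log v ^ 4 * (v / (1 + v ^ 2) ^ 2)) / 2 * Real.log (1 / (α * k₁ * k₂)) ^ 2 + E₃₂))| ≤
      (∑ k ∈ Icc 1 ⌊Y⌋₊, |a₁ k| * ellp Y k ^ i) * (B * (Real.log Y ^ j * (3 * C₀ * Real.sqrt (2 * α * K₁ * Y)))) +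
        (∑ k ∈ Icc 1 ⌊Y⌋₊, |a₂ k| * ellp Y k ^ j) *
          ((2 * η) * (Real.log Y ^ i * (9 * C₀ * (1 + |Real.log (2 * α * Y ^ 2)|) ^ 8))) ∧
    |∑ k₁ ∈ Icc 1 ⌊Y⌋₊, ∑ k₂ ∈ Icc 1 ⌊Y⌋₊,
        a₁ k₁ * a₂ k₂ * ellp Y k₁ ^ i * ellp Y k₂ ^ j *
          ((∫ u₁ in Set.Ioi (0 : ℝ), Real.log u₁ ^ 3 * ∫ u₂ in Set.Ioi ((α * k₁ * k₂) / u₁),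
              Real.exp (-(u₁ + u₂)) / (1 - Real.exp (-(u₁ + u₂))) ^ 2 * Real.log u₂ ^ 3) -
            (Real.log (1 / (α * k₁ * k₂)) ^ 7 / 896 - 3 * (∫ v in Set.Ioc (0 : ℝ) 1, Real.log v ^ 2 * (v / (1 + v ^ 2) ^ 2)) / 40 * Real.log (1 / (α * k₁ * k₂)) ^ 5 + (∫ v in Set.Ioc (0 : ℝ) 1, Real.log v ^ 4 * (v / (1 + v ^ 2) ^ 2)) / 2 * Real.log (1 / (α * k₁ * k₂)) ^ 3 - 2 * (∫ v in Set.Ioc (0 : ℝ) 1, Real.log v ^ 6 * (v / (1 + v ^ 2) ^ 2)) * Real.log (1 / (α * k₁ * k₂)) + E₃₃))| ≤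
      (∑ k ∈ Icc 1 ⌊Y⌋₊, |a₁ k| * ellp Y k ^ i) * (B * (Real.log Y ^ j * (3 * C₀ * Real.sqrt (2 * α * K₁ * Y)))) +
        (∑ k ∈ Icc 1 ⌊Y⌋₊, |a₂ k| * ellp Y k ^ j) *
          ((2 * η) * (Real.log Y ^ i * (9 * C₀ * (1 + |Real.log (2 * α * Y ^ 2)|) ^ 8))) := by
  obtain ⟨C₂₃, hC₂₃, h₂₃⟩ := abs_doubleSum_bose_rem_le₂ 2 3
  obtain ⟨C₃₀, hC₃₀, h₃₀⟩ := abs_doubleSum_bose_rem_le₂ 3 0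
  obtain ⟨C₃₁, hC₃₁, h₃₁⟩ := abs_doubleSum_bose_rem_le₂ 3 1
  obtain ⟨C₃₂, hC₃₂, h₃₂⟩ := abs_doubleSum_bose_rem_le₂ 3 2
  obtain ⟨C₃₃, hC₃₃, h₃₃⟩ := abs_doubleSum_bose_rem_le₂ 3 3
  set C₀ : ℝ := max (max (max C₂₃ C₃₀) (max C₃₁ C₃₂)) C₃₃ with hC₀
  have e₂₃ : C₂₃ ≤ C₀ := ((le_max_left _ _).trans (le_max_left _ _)).trans (le_max_left _ _)
  have e₃₀ : C₃₀ ≤ C₀ := ((le_max_right _ _).trans (le_max_left _ _)).trans (le_max_left _ _)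
  have e₃₁ : C₃₁ ≤ C₀ := ((le_max_left _ _).trans (le_max_right _ _)).trans (le_max_left _ _)
  have e₃₂ : C₃₂ ≤ C₀ := ((le_max_right _ _).trans (le_max_right _ _)).trans (le_max_left _ _)
  have e₃₃ : C₃₃ ≤ C₀ := le_max_right _ _
  have hC₀0 : 0 ≤ C₀ := hC₂₃.trans e₂₃
  refine ⟨(∫ u₁ in Set.Ioi (0 : ℝ), Real.log u₁ ^ 2 * ∫ u₂ in Set.Ioi (1 / u₁),
        Real.exp (-(u₁ + u₂)) / (1 - Real.exp (-(u₁ + u₂))) ^ 2 * Real.log u₂ ^ 3) +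
      (∫ η in Set.Ioc (0 : ℝ) 1, (η * (∫ u in Set.Ioi (0 : ℝ), Real.log u ^ 2 * Real.log (η / u) ^ 3 *
            (Real.exp (-(u + η / u)) / (1 - Real.exp (-(u + η / u))) ^ 2) / u) -
          ∫ v in Set.Ioc (0 : ℝ) 1, ((-(Real.log (1 / η) / 2) + Real.log v) ^ 2 * (-(Real.log (1 / η) / 2) - Real.log v) ^ 3 +
              (-(Real.log (1 / η) / 2) - Real.log v) ^ 2 * (-(Real.log (1 / η) / 2) + Real.log v) ^ 3) *
            (v / (1 + v ^ 2) ^ 2)) / η),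
    (∫ u₁ in Set.Ioi (0 : ℝ), Real.log u₁ ^ 3 * ∫ u₂ in Set.Ioi (1 / u₁),
        Real.exp (-(u₁ + u₂)) / (1 - Real.exp (-(u₁ + u₂))) ^ 2 * Real.log u₂ ^ 0) +
      (∫ η in Set.Ioc (0 : ℝ) 1, (η * (∫ u in Set.Ioi (0 : ℝ), Real.log u ^ 3 * Real.log (η / u) ^ 0 *
            (Real.exp (-(u + η / u)) / (1 - Real.exp (-(u + η / u))) ^ 2) / u) -
          ∫ v in Set.Ioc (0 : ℝ) 1, ((-(Real.log (1 / η) / 2) + Real.log v) ^ 3 * (-(Real.log (1 / η) / 2) - Real.log v) ^ 0 +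
              (-(Real.log (1 / η) / 2) - Real.log v) ^ 3 * (-(Real.log (1 / η) / 2) + Real.log v) ^ 0) *
            (v / (1 + v ^ 2) ^ 2)) / η),
    (∫ u₁ in Set.Ioi (0 : ℝ), Real.log u₁ ^ 3 * ∫ u₂ in Set.Ioi (1 / u₁),
        Real.exp (-(u₁ + u₂)) / (1 - Real.exp (-(u₁ + u₂))) ^ 2 * Real.log u₂ ^ 1) +
      (∫ η in Set.Ioc (0 : ℝ) 1, (η * (∫ u in Set.Ioi (0 : ℝ), Real.log u ^ 3 * Real.log (η / u) ^ 1 *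
            (Real.exp (-(u + η / u)) / (1 - Real.exp (-(u + η / u))) ^ 2) / u) -
          ∫ v in Set.Ioc (0 : ℝ) 1, ((-(Real.log (1 / η) / 2) + Real.log v) ^ 3 * (-(Real.log (1 / η) / 2) - Real.log v) ^ 1 +
              (-(Real.log (1 / η) / 2) - Real.log v) ^ 3 * (-(Real.log (1 / η) / 2) + Real.log v) ^ 1) *
            (v / (1 + v ^ 2) ^ 2)) / η),
    (∫ u₁ in Set.Ioi (0 : ℝ), Real.log u₁ ^ 3 * ∫ u₂ in Set.Ioi (1 / u₁),
        Real.exp (-(u₁ + u₂)) / (1 - Real.exp (-(u₁ + u₂))) ^ 2 * Real.log u₂ ^ 2) +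
      (∫ η in Set.Ioc (0 : ℝ) 1, (η * (∫ u in Set.Ioi (0 : ℝ), Real.log u ^ 3 * Real.log (η / u) ^ 2 *
            (Real.exp (-(u + η / u)) / (1 - Real.exp (-(u + η / u))) ^ 2) / u) -
          ∫ v in Set.Ioc (0 : ℝ) 1, ((-(Real.log (1 / η) / 2) + Real.log v) ^ 3 * (-(Real.log (1 / η) / 2) - Real.log v) ^ 2 +
              (-(Real.log (1 / η) / 2) - Real.log v) ^ 3 * (-(Real.log (1 / η) / 2) + Real.log v) ^ 2) *
            (v / (1 + v ^ 2) ^ 2)) / η),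
    (∫ u₁ in Set.Ioi (0 : ℝ), Real.log u₁ ^ 3 * ∫ u₂ in Set.Ioi (1 / u₁),
        Real.exp (-(u₁ + u₂)) / (1 - Real.exp (-(u₁ + u₂))) ^ 2 * Real.log u₂ ^ 3) +
      (∫ η in Set.Ioc (0 : ℝ) 1, (η * (∫ u in Set.Ioi (0 : ℝ), Real.log u ^ 3 * Real.log (η / u) ^ 3 *
            (Real.exp (-(u + η / u)) / (1 - Real.exp (-(u + η / u))) ^ 2) / u) -
          ∫ v in Set.Ioc (0 : ℝ) 1, ((-(Real.log (1 / η) / 2) + Real.log v) ^ 3 * (-(Real.log (1 / η) / 2) - Real.log v) ^ 3 +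
              (-(Real.log (1 / η) / 2) - Real.log v) ^ 3 * (-(Real.log (1 / η) / 2) + Real.log v) ^ 3) *
            (v / (1 + v ^ 2) ^ 2)) / η),
    C₀, hC₀0, fun a₁ a₂ Y α B η K₁ i j hY hα hi hj hB hη hY₁ ↦ ?_⟩
  have hY0 : 0 < Y := by linarith
  have hη0 : 0 ≤ η := (abs_nonneg _).trans (hη K₁ le_rfl)
  have hLY : 0 ≤ Real.log Y := Real.log_nonneg hY
  have hx : (1 : ℝ) ≤ 1 + |Real.log (2 * α * Y ^ 2)| := by linarith [abs_nonneg (Real.log (2 * α * Y ^ 2))]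
  have hSj : 0 ≤ ∑ k ∈ Icc 1 ⌊Y⌋₊, |a₂ k| * ellp Y k ^ j :=
    Finset.sum_nonneg fun k _ ↦ mul_nonneg (abs_nonneg _) (pow_nonneg (ellp_nonneg Y k) j)
  have hSi : 0 ≤ ∑ k ∈ Icc 1 ⌊Y⌋₊, |a₁ k| * ellp Y k ^ i :=
    Finset.sum_nonneg fun k _ ↦ mul_nonneg (abs_nonneg _) (pow_nonneg (ellp_nonneg Y k) i)
  have hB0 : 0 ≤ B := (abs_nonneg _).trans (hB 0 (Nat.zero_le _))
  have hsq : 0 ≤ Real.sqrt (2 * α * K₁ * Y) := Real.sqrt_nonneg _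
  have hc32 : Nat.choose 3 2 = 3 := by decide
  have hfirst : ∀ {C : ℝ}, C ≤ C₀ →
      (∑ k ∈ Icc 1 ⌊Y⌋₊, |a₁ k| * ellp Y k ^ i) * (B * (Real.log Y ^ j * (3 * C * Real.sqrt (2 * α * K₁ * Y)))) ≤
      (∑ k ∈ Icc 1 ⌊Y⌋₊, |a₁ k| * ellp Y k ^ i) * (B * (Real.log Y ^ j * (3 * C₀ * Real.sqrt (2 * α * K₁ * Y)))) := by
    intro C hC
    have hLj : 0 ≤ Real.log Y ^ j := pow_nonneg hLY j
    gcongr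
  have hsecond : ∀ {C : ℝ} {N : ℕ}, 0 ≤ C → C ≤ C₀ →
      (∑ k ∈ Icc 1 ⌊Y⌋₊, |a₂ k| * ellp Y k ^ j) * ((2 * η) * (Real.log Y ^ i *
          (3 * (C + C * (1 + |Real.log (2 * α * Y ^ 2)|) ^ N) + 2 * C +
            C * (1 + |Real.log (2 * α * Y ^ 2)|) ^ N * (1 + |Real.log (2 * α * Y ^ 2)|)))) ≤
      (∑ k ∈ Icc 1 ⌊Y⌋₊, |a₂ k| * ellp Y k ^ j) * ((2 * η) * (Real.log Y ^ i *
          (3 * (C₀ + C₀ * (1 + |Real.log (2 * α * Y ^ 2)|) ^ N) + 2 * C₀ +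
            C₀ * (1 + |Real.log (2 * α * Y ^ 2)|) ^ N * (1 + |Real.log (2 * α * Y ^ 2)|)))) := by
    intro C N hC hCC
    have hLi : 0 ≤ Real.log Y ^ i := pow_nonneg hLY i
    have hxN : 0 ≤ (1 + |Real.log (2 * α * Y ^ 2)|) ^ N := pow_nonneg (by positivity) N
    gcongr
  refine ⟨?_, ?_, ?_, ?_, ?_⟩
  · have h := h₂₃ a₁ a₂ Y α B η K₁ i j hY hα hi hj hB hη hY₁
    have h' := le_trans h (add_le_add (hfirst e₂₃) (hsecond hC₂₃ e₂₃))
    have h'' := weaken_second_term8 hSj hη0 hLY hC₀0 hx (by norm_num : 2 + 3 + 1 ≤ 7) h'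
    refine le_trans (le_of_eq ?_) h''
    congr 1
    refine Finset.sum_congr rfl fun k₁ _ ↦ Finset.sum_congr rfl fun k₂ _ ↦ ?_
    simp only [Finset.sum_range_succ, Finset.sum_range_zero, zero_add, add_zero, Nat.choose_self,
      Nat.choose_zero_right, Nat.choose_one_right, hc32, Nat.cast_one, Nat.cast_ofNat, Nat.sub_self, Nat.sub_zero,
      Nat.reduceSub, Nat.reduceAdd, Nat.cast_zero, Nat.cast_add, pow_zero, pow_one, one_mul, mul_one,
      integral_model_weight_Ioc]
    ring
  · have h := h₃₀ a₁ a₂ Y α B η K₁ i j hY hα hi hj hB hη hY₁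
    have h' := le_trans h (add_le_add (hfirst e₃₀) (hsecond hC₃₀ e₃₀))
    have h'' := weaken_second_term8 hSj hη0 hLY hC₀0 hx (by norm_num : 3 + 0 + 1 ≤ 7) h'
    refine le_trans (le_of_eq ?_) h''
    congr 1
    refine Finset.sum_congr rfl fun k₁ _ ↦ Finset.sum_congr rfl fun k₂ _ ↦ ?_
    simp only [Finset.sum_range_succ, Finset.sum_range_zero, zero_add, add_zero, Nat.choose_self,
      Nat.choose_zero_right, Nat.choose_one_right, hc32, Nat.cast_one, Nat.cast_ofNat, Nat.sub_self, Nat.sub_zero,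
      Nat.reduceSub, Nat.reduceAdd, Nat.cast_zero, Nat.cast_add, pow_zero, pow_one, one_mul, mul_one,
      integral_model_weight_Ioc]
    ring
  · have h := h₃₁ a₁ a₂ Y α B η K₁ i j hY hα hi hj hB hη hY₁
    have h' := le_trans h (add_le_add (hfirst e₃₁) (hsecond hC₃₁ e₃₁))
    have h'' := weaken_second_term8 hSj hη0 hLY hC₀0 hx (by norm_num : 3 + 1 + 1 ≤ 7) h'
    refine le_trans (le_of_eq ?_) h''
    congr 1
    refine Finset.sum_congr rfl fun k₁ _ ↦ Finset.sum_congr rfl fun k₂ _ ↦ ?_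
    simp only [Finset.sum_range_succ, Finset.sum_range_zero, zero_add, add_zero, Nat.choose_self,
      Nat.choose_zero_right, Nat.choose_one_right, hc32, Nat.cast_one, Nat.cast_ofNat, Nat.sub_self, Nat.sub_zero,
      Nat.reduceSub, Nat.reduceAdd, Nat.cast_zero, Nat.cast_add, pow_zero, pow_one, one_mul, mul_one,
      integral_model_weight_Ioc]
    ring
  · have h := h₃₂ a₁ a₂ Y α B η K₁ i j hY hα hi hj hB hη hY₁
    have h' := le_trans h (add_le_add (hfirst e₃₂) (hsecond hC₃₂ e₃₂))
    have h'' := weaken_second_term8 hSj hη0 hLY hC₀0 hx (by norm_num : 3 + 2 + 1 ≤ 7) h'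
    refine le_trans (le_of_eq ?_) h''
    congr 1
    refine Finset.sum_congr rfl fun k₁ _ ↦ Finset.sum_congr rfl fun k₂ _ ↦ ?_
    simp only [Finset.sum_range_succ, Finset.sum_range_zero, zero_add, add_zero, Nat.choose_self,
      Nat.choose_zero_right, Nat.choose_one_right, hc32, Nat.cast_one, Nat.cast_ofNat, Nat.sub_self, Nat.sub_zero,
      Nat.reduceSub, Nat.reduceAdd, Nat.cast_zero, Nat.cast_add, pow_zero, pow_one, one_mul, mul_one,
      integral_model_weight_Ioc]
    ring
  · have h := h₃₃ a₁ a₂ Y α B η K₁ i j hY hα hi hj hB hη hY₁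
    have h' := le_trans h (add_le_add (hfirst e₃₃) (hsecond hC₃₃ e₃₃))
    have h'' := weaken_second_term8 hSj hη0 hLY hC₀0 hx (by norm_num : 3 + 3 + 1 ≤ 7) h'
    refine le_trans (le_of_eq ?_) h''
    congr 1
    refine Finset.sum_congr rfl fun k₁ _ ↦ Finset.sum_congr rfl fun k₂ _ ↦ ?_
    simp only [Finset.sum_range_succ, Finset.sum_range_zero, zero_add, add_zero, Nat.choose_self,
      Nat.choose_zero_right, Nat.choose_one_right, hc32, Nat.cast_one, Nat.cast_ofNat, Nat.sub_self, Nat.sub_zero,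
      Nat.reduceSub, Nat.reduceAdd, Nat.cast_zero, Nat.cast_add, pow_zero, pow_one, one_mul, mul_one,
      integral_model_weight_Ioc]
    ring

/-- **Two-sequence estimate and small-argument pointwise bound for the continued Bose remainder `r_ab` (generic KMV form) under ONE
constant**: for every `(a,b)` there is `C₀ ≥ 0` with the two-variable Abel estimate of `…DiagRemBoseTwoSeq.abs_doubleSum_bose_rem_le₂`
AND `|r_ab(y)| ≤ C₀√y` for `0 < y ≤ 1` (the corner input of the δ-subtraction of both-sided monomials, `…DiagRemTwoTwoDeltaSub`).
[cite: KowalskiMichelVanderKam2000, Prop. 5.1 — derivation (corner of the diagonal, general Q, remainder of the weight)] -/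
theorem abs_bose_rem_twoSeq_and_small (a b : ℕ) : ∃ C₀ : ℝ, 0 ≤ C₀ ∧
    (∀ (a₁ a₂ : ℕ → ℝ) (Y α B η : ℝ) (K₁ i j : ℕ), 1 ≤ Y → 0 < α → 1 ≤ i → 1 ≤ j →
      (∀ e : ℕ, e ≤ ⌊Y⌋₊ → |∑ k ∈ Icc 1 e, a₂ k| ≤ B) → (∀ e : ℕ, K₁ ≤ e → |∑ k ∈ Icc 1 e, a₁ k| ≤ η) →
      2 * α * K₁ * Y ≤ 1 →
    |∑ k₁ ∈ Icc 1 ⌊Y⌋₊, ∑ k₂ ∈ Icc 1 ⌊Y⌋₊,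
        a₁ k₁ * a₂ k₂ * ellp Y k₁ ^ i * ellp Y k₂ ^ j *
          ((∫ u₁ in Set.Ioi (0 : ℝ), Real.log u₁ ^ a *
              ∫ u₂ in Set.Ioi ((α * k₁ * k₂) / u₁), Real.exp (-(u₁ + u₂)) / (1 - Real.exp (-(u₁ + u₂))) ^ 2 *
                Real.log u₂ ^ b) -
            ((∫ u₁ in Set.Ioi (0 : ℝ), Real.log u₁ ^ a *
                ∫ u₂ in Set.Ioi (1 / u₁), Real.exp (-(u₁ + u₂)) / (1 - Real.exp (-(u₁ + u₂))) ^ 2 * Real.log u₂ ^ b) +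
              (∫ η in Set.Ioc (0 : ℝ) 1, (η * (∫ u in Set.Ioi (0 : ℝ), Real.log u ^ a * Real.log (η / u) ^ b *
                  (Real.exp (-(u + η / u)) / (1 - Real.exp (-(u + η / u))) ^ 2) / u) -
                ∫ v in Set.Ioc (0 : ℝ) 1, ((-(Real.log (1 / η) / 2) + Real.log v) ^ a *
                    (-(Real.log (1 / η) / 2) - Real.log v) ^ b +
                  (-(Real.log (1 / η) / 2) - Real.log v) ^ a * (-(Real.log (1 / η) / 2) + Real.log v) ^ b) *
                  (v / (1 + v ^ 2) ^ 2)) / η) +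
              ∑ i' ∈ Finset.range (a + 1), ∑ j' ∈ Finset.range (b + 1),
                (a.choose i' : ℝ) * (b.choose j' : ℝ) * ((-1) ^ j' + (-1) ^ i') *
                  (∫ v in Set.Ioc (0 : ℝ) 1, Real.log v ^ (i' + j') * (v / (1 + v ^ 2) ^ 2)) *
                  ((-1 / 2 : ℝ) ^ (a - i' + (b - j')) * Real.log (1 / (α * k₁ * k₂)) ^ (a - i' + (b - j') + 1) /
                    (((a - i' + (b - j') : ℕ) : ℝ) + 1))))| ≤
      (∑ k ∈ Icc 1 ⌊Y⌋₊, |a₁ k| * ellp Y k ^ i) *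
          (B * (Real.log Y ^ j * (3 * C₀ * Real.sqrt (2 * α * K₁ * Y)))) +
        (∑ k ∈ Icc 1 ⌊Y⌋₊, |a₂ k| * ellp Y k ^ j) * ((2 * η) * (Real.log Y ^ i *
          (3 * (C₀ + C₀ * (1 + |Real.log (2 * α * Y ^ 2)|) ^ (a + b + 1)) + 2 * C₀ +
            C₀ * (1 + |Real.log (2 * α * Y ^ 2)|) ^ (a + b + 1) * (1 + |Real.log (2 * α * Y ^ 2)|))))) ∧
    (∀ y : ℝ, 0 < y → y ≤ 1 →
      |((∫ u₁ in Set.Ioi (0 : ℝ), Real.log u₁ ^ a *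
              ∫ u₂ in Set.Ioi (y / u₁), Real.exp (-(u₁ + u₂)) / (1 - Real.exp (-(u₁ + u₂))) ^ 2 *
                Real.log u₂ ^ b) -
            ((∫ u₁ in Set.Ioi (0 : ℝ), Real.log u₁ ^ a *
                ∫ u₂ in Set.Ioi (1 / u₁), Real.exp (-(u₁ + u₂)) / (1 - Real.exp (-(u₁ + u₂))) ^ 2 * Real.log u₂ ^ b) +
              (∫ η in Set.Ioc (0 : ℝ) 1, (η * (∫ u in Set.Ioi (0 : ℝ), Real.log u ^ a * Real.log (η / u) ^ b *
                  (Real.exp (-(u + η / u)) / (1 - Real.exp (-(u + η / u))) ^ 2) / u) -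
                ∫ v in Set.Ioc (0 : ℝ) 1, ((-(Real.log (1 / η) / 2) + Real.log v) ^ a *
                    (-(Real.log (1 / η) / 2) - Real.log v) ^ b +
                  (-(Real.log (1 / η) / 2) - Real.log v) ^ a * (-(Real.log (1 / η) / 2) + Real.log v) ^ b) *
                  (v / (1 + v ^ 2) ^ 2)) / η) +
              ∑ i' ∈ Finset.range (a + 1), ∑ j' ∈ Finset.range (b + 1),
                (a.choose i' : ℝ) * (b.choose j' : ℝ) * ((-1) ^ j' + (-1) ^ i') *
                  (∫ v in Set.Ioc (0 : ℝ) 1, Real.log v ^ (i' + j') * (v / (1 + v ^ 2) ^ 2)) *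
                  ((-1 / 2 : ℝ) ^ (a - i' + (b - j')) * Real.log (1 / y) ^ (a - i' + (b - j') + 1) /
                    (((a - i' + (b - j') : ℕ) : ℝ) + 1))))| ≤ C₀ * Real.sqrt y) := by
  obtain ⟨C₁, hC₁, h₁⟩ := abs_doubleSum_bose_rem_le₂ a b
  obtain ⟨Cs, hs⟩ := abs_bose_rem_small_le_sqrt a b
  set C₀ : ℝ := max C₁ |Cs| with hC₀
  have e₁ : C₁ ≤ C₀ := le_max_left _ _
  have es : Cs ≤ C₀ := (le_abs_self _).trans (le_max_right _ _)
  have hC₀0 : 0 ≤ C₀ := hC₁.trans e₁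
  refine ⟨C₀, hC₀0, fun a₁ a₂ Y α B η K₁ i j hY hα hi hj hB hη hY₁ ↦ ?_, fun y hy0 hy1 ↦ ?_⟩
  · have hη0 : 0 ≤ η := (abs_nonneg _).trans (hη K₁ le_rfl)
    have hLY : 0 ≤ Real.log Y := Real.log_nonneg hY
    have hSj : 0 ≤ ∑ k ∈ Icc 1 ⌊Y⌋₊, |a₂ k| * ellp Y k ^ j :=
      Finset.sum_nonneg fun k _ ↦ mul_nonneg (abs_nonneg _) (pow_nonneg (ellp_nonneg Y k) j)
    have hSi : 0 ≤ ∑ k ∈ Icc 1 ⌊Y⌋₊, |a₁ k| * ellp Y k ^ i :=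
      Finset.sum_nonneg fun k _ ↦ mul_nonneg (abs_nonneg _) (pow_nonneg (ellp_nonneg Y k) i)
    have hB0 : 0 ≤ B := (abs_nonneg _).trans (hB 0 (Nat.zero_le _))
    have hsq : 0 ≤ Real.sqrt (2 * α * K₁ * Y) := Real.sqrt_nonneg _
    have hLi : 0 ≤ Real.log Y ^ i := pow_nonneg hLY i
    have hLj : 0 ≤ Real.log Y ^ j := pow_nonneg hLY j
    have hxN : 0 ≤ (1 + |Real.log (2 * α * Y ^ 2)|) ^ (a + b + 1) := pow_nonneg (by positivity) _
    have hx0 : 0 ≤ 1 + |Real.log (2 * α * Y ^ 2)| := by positivity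
    refine (h₁ a₁ a₂ Y α B η K₁ i j hY hα hi hj hB hη hY₁).trans ?_
    gcongr
  · exact (hs y hy0 hy1).trans (mul_le_mul_of_nonneg_right es (Real.sqrt_nonneg y))

end Summit.Parity.GeneralizedHardyLittlewood.Theorems.MomentsBeyondDiagonal.DiagCorner

end
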